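import Mathlib
import Summits.ValiantsHypothesis.ValiantsHypothesis.Theorems.GrenetZeonTwoDimCoefficientsScalingRayDisc
import Summits.ValiantsHypothesis.ValiantsHypothesis.Theorems.GrenetZeonTwoDimCoefficientsScalingCompanionDegree

/-!
# Crux `GrenetZeon.TwoDimCoefficients` (stmt-ValiantsHypothesis-8062), stub `stub_dualUnipotent`:
# scaling-closure — the 3/2 rung from ONE good ray point (counting form of ray interpolation)

✓ `rank_hess0_perPoly_le_of_simpleRayRoots` bounds `rank Hess per_n(z₀) ≤ 2J·m` at every point `z₀` whose ray polynomial
has `J` distinct simple roots (`J` = top companion order).  Since a non-zero top companion `[D_J]_{Jn}` forces `J·n ≤ m`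
(`deg D_J ≤ m`, ✓ `totalDegree_coeff_det_le`), ONE such point at which the permanent's Hessian is non-degenerate gives the
3/2 rung:

* ★ `cube_le_two_mul_sq_of_simpleRayRoots` — `… ∧ rank Hess per_n(z₀) = n²` ⟹ `n³ ≤ 2m²` (the bound of crux
  `DualUnipotentThreeHalves`, stmt-24318, with `C = 2`).

The existence of such a point is exactly "the shadow `Φ = c + Σ_k [D_k]_{kn}` is squarefree" (then generic rays have simple
roots, and `Hess per_n` is generically non-degenerate by the Mignon–Ressayre point ✓ `rank_mrHess`); typing that generic-point
step needs a discriminant/resultant API and is recorded as R9 in memo SEVENTEENTH-HAND.md.  Non-squarefree shadows are the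
residual (L1′).

HONEST FRAMING: a conditional rung; the stub `DualUnipotentBound`, both cruxes and `VP ≠ VNP` remain open.

References: T. Mignon, N. Ressayre, Int. Math. Res. Not. 2004:79, Thm. 1.1 (via the tree); folklore.
-/

-- single-conjunct layout `Summits/ValiantsHypothesis/ValiantsHypothesis`: the duplicated namespace
-- component is mandated by the tree.
set_option linter.dupNamespace false
set_option autoImplicit false

noncomputable section

namespace Summit.ValiantsHypothesis.ValiantsHypothesis.Theorems.GrenetZeonTwoDimCoefficients.ScalingClosure

open MvPolynomial Matrix
open Literature.Computability.AlgebraicComplexity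
open Summit.ValiantsHypothesis.ValiantsHypothesis.Cruxes.TwoDimCoefficients.DimTwoCases

section Count

variable {n m : ℕ}

/-- A non-zero companion of order `J` forces `J·n ≤ m`. [folklore] -/
theorem mul_le_of_topCompanion_ne_zero (A B : AffMat n m) (hA : IsAffine A) (hB : IsAffine B) {J : ℕ}
    (hJ : homogeneousComponent (J * n) ((det ((Polynomial.X : Polynomial (MvPolynomial (Fin n × Fin n) ℂ)) •
      B.map Polynomial.C + A.map Polynomial.C)).coeff J) ≠ 0) :
    J * n ≤ m := by
  by_contra h
  refine hJ (homogeneousComponent_eq_zero _ _ ?_)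
  have hdeg := totalDegree_coeff_det_le A B hA hB J
  rw [Fintype.card_fin] at hdeg
  omega

/-- ★ **The 3/2 rung from one good ray point.**  In the situation of ✓ `rank_hess0_perPoly_le_of_simpleRayRoots`
(hdeg pencil, top companion order `J`, a point `z₀` whose ray polynomial has `J` distinct simple roots), if moreover the top
companion `[D_J]_{Jn}` is non-zero and `Hess per_n(z₀)` is non-degenerate, then `n³ ≤ 2m²`.
[cite: MignonRessayre2004, Thm. 1.1 — via the tree; folklore] -/
theorem cube_le_two_mul_sq_of_simpleRayRoots (A B : AffMat n m) (hA : IsAffine A) (hB : IsAffine B)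
    (α β c : ℂ) (hc : c ≠ 0) (hβ : β ≠ 0) (hdet : A.det = MvPolynomial.C c)
    (hper : perPoly (Fin n) ℂ = MvPolynomial.C α * A.det + MvPolynomial.C β * (A.adjugate * B).trace)
    (hn : 2 ≤ n) (hm2 : 2 ≤ m) (D : ℕ → MvPolynomial (Fin n × Fin n) ℂ)
    (hD : ∀ k, D k = (det ((Polynomial.X : Polynomial (MvPolynomial (Fin n × Fin n) ℂ)) •
      B.map Polynomial.C + A.map Polynomial.C)).coeff k)
    (hdeg : ∀ k, 2 ≤ k → ∀ d, k * n < d → homogeneousComponent d (D k) = 0)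
    {J : ℕ} (hJ1 : 1 ≤ J) (hJtop : homogeneousComponent (J * n) (D J) ≠ 0)
    (hJ : ∀ k, J < k → k ≤ m → homogeneousComponent (k * n) (D k) = 0)
    (z₀ : Fin n × Fin n → ℂ) (t : Fin J → ℂ) (ht : Function.Injective t)
    (hroot : ∀ i, c + ∑ e : Fin J, t i ^ ((e : ℕ) + 1) * eval z₀ (homogeneousComponent (((e : ℕ) + 1) * n) (D (e + 1)))
      = 0)
    (hsimple : ∀ i, ∑ e : Fin J, (((e : ℕ) + 1 : ℕ) : ℂ) * (t i ^ ((e : ℕ) + 1) *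
      eval z₀ (homogeneousComponent (((e : ℕ) + 1) * n) (D (e + 1)))) ≠ 0)
    (hfull : (hess0 (transl z₀ (perPoly (Fin n) ℂ))).rank = n ^ 2) :
    n ^ 3 ≤ 2 * m ^ 2 := by
  have hJn : J * n ≤ m := by
    refine mul_le_of_topCompanion_ne_zero A B hA hB ?_
    rw [← hD]; exact hJtop
  have h := rank_hess0_perPoly_le_of_simpleRayRoots A B hA hB α β c hc hβ hdet hper hn hm2 D hD hdeg hJ1
    (le_trans (Nat.le_mul_of_pos_right J (by omega)) hJn) hJ z₀ t ht hroot hsimple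
  rw [hfull] at h
  calc n ^ 3 = n ^ 2 * n := by ring
    _ ≤ J * (2 * m) * n := Nat.mul_le_mul_right _ h
    _ = 2 * m * (J * n) := by ring
    _ ≤ 2 * m * m := Nat.mul_le_mul_left _ hJn
    _ = 2 * m ^ 2 := by ring

end Count

end Summit.ValiantsHypothesis.ValiantsHypothesis.Theorems.GrenetZeonTwoDimCoefficients.ScalingClosure

end
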